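import Summits.QuantumFields.YangMills.Theorems.BalabanUVNodesN15CovariantLandauPropagatorRows
import Summits.QuantumFields.YangMills.Theorems.BalabanUVNodesN15CovariantLandauPropagatorDefectRow
import Summits.QuantumFields.YangMills.Theorems.BalabanUVNodesN15TwoSpacingGluingCurvedKnitCovariantAveragingNode
import Summits.QuantumFields.YangMills.Theorems.BalabanUVNodesN15AnyPropagatorSandwichObjects
import HarnessLib

/-!
# N15 = NE2 — dag-n15-a g32 (t2), F5: ★★★ dag-n15-c's (P-R) PROPAGATOR FAMILY `X_r` (Bałaban's whole covariant summand `a·Q*Q − D_U(I−R)D*_U` live INSIDE the propagator) MEETS THE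
# THREE DISPLAYED ROWS OF (𝟙P-c′)∕(𝟙P-d′) UNDER BAŁABAN's CLASS (3.35), GIVEN n15-c∕211's THREE GLOBAL LANDAU ROWS — `rows_sfqr`
# (dag-n15-a g32, (t2) FILE F5; node N15 = NE2; `--supports stmt-QuantumFields-27366 --as helper`, count-neutral; one theorem; imports F3, F4, n15-c 189b)

WHY.  (𝟙P-c′)∕(𝟙P-d′) close the site ∕ unit layers BY NAME for any inner propagator family with three rows DISPLAYED per index under `Reg335 c₃₅ α₀ A′` (`hX`: sizes `K_X·(c₃₅L^mα₀)`, two-grid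
defect `K_X·(L^k)^{−γ_X}`).  (t2) F3∕F4 give exactly these rows for dag-n15-c's `X_r` in n15-c∕206's regime (skew `A′` in the C² window at scale `r_A ≤ 1`, transporter sizes `≤ 1`, Landau
letters in the budgets) GIVEN n15-c∕211's three cut-off-free Landau rows.  This file is n15-c 189b's threshold template applied to them — (𝟙P-e″) `rows_sfq`'s text with the Landau size
letter `c_R·r_A` inside both budgets and 206's bracket (with the Landau η-defect `C_R(L^k)^{−γ_R}`) bounded by `(1 + C₁ + 2C_R)(L^k)^{−γ_X}`, `γ_X = min γ_R (1∕16)`.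

THE RESULT ★★★ `rows_sfqr … (he) (hδR) (hcR) (hCR) (hG) : ∃ ρX KX wX sX, …` = (𝟙P-c′)'s hypothesis `hX` for `(Xc, Xf) := (X_r, X′_r)` at `γ_X = min γ_R (1∕16)`, LITERALLY; `hG` is the
body of n15-c∕211 `ne2PlusOperator_sfqr_of_global`'s hypothesis `hG` (its four letters as parameters).

HONEST FRAMING ∕ LIMITS.  MODEL carriers ∕ operators of dag-n15-c (doubled torus `2L^{m+1}`, `L ≥ 7`, global small-field gauge `U = e^{ηĀ′}`∕`U′ = e^{η′A′}`, `Q(U)` = main term (125) of [B7]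
(124), King-block-mean pairing, crude constants); the three Landau rows are HYPOTHESES (dag-n15-c's located-next analytic object, [B9] §1∕(3.49)); the (3.35) window is used only through FILE
130's letters; NOT [B9] (3.62)–(3.65) ∕ Thm 3.1 ∕ Thm 3.4 as printed and no estimate of Bałaban's; no layer knit here (the sequel F6); N15 stays DISCHARGED OF RECORD 8∕28 AS CONSUMED
(U-blind v7 pin, p687738) — nothing re-claimed, no count moved; K3⁸ OPEN; finite 𝕋⁴ per index — NOT ℝ⁴ ∕ OS ∕ mass gap ∕ Clay.  `set_option maxHeartbeats 800000 in` ×1 (189b's budget).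
No `sorry`, `instance`, `notation`; standard axioms.
-/

noncomputable section

open scoped BigOperators Matrix

namespace Summit.QuantumFields.YangMills.BalabanUVNodes.N15.SiteLayerSf

open Literature.MathematicalPhysics.QuantumFieldTheory.Balaban1983to89
open Literature.MathematicalPhysics.QuantumFieldTheory.Balaban1983to89.B11SectG (BlockNorm HasMaj)
open Literature.MathematicalPhysics.QuantumFieldTheory.Balaban1983to89.B5Prop11Plancherel (Tor fine)
open Literature.MathematicalPhysics.QuantumFieldTheory.Balaban1983to89.B6UnitTorusCarrier (unitTorusGeo unitTorusGeo_dist_nonneg)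
open Literature.MathematicalPhysics.QuantumFieldTheory.Balaban1983to89.T4EtaRateDefect (idef)
open Literature.MathematicalPhysics.QuantumFieldTheory.Balaban1983to89.T4EtaRateCoeffDefect (pull)
open Literature.MathematicalPhysics.QuantumFieldTheory.King1986.Torus (blockOf tdistT)
open Literature.Barriers.QuantumFields (traceForm)
open Summit.QuantumFields.YangMills.BalabanUVNodes.N15.SiteLayer (hasMaj_exp_mono)
open Summit.QuantumFields.YangMills.BalabanUVNodes.N15.BackgroundLayer (gavgM)
open Summit.QuantumFields.YangMills.BalabanUVNodes.N15.VectorPiece (bshiftEquiv kingPrV tensorId)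
open Summit.QuantumFields.YangMills.BalabanUVNodes.N15.MatrixSpecies (basisConst basisConst_nonneg liftBlk liftMap)
open Summit.QuantumFields.YangMills.BalabanUVNodes.N15.TwoGrid (gOp)
open Summit.QuantumFields.YangMills.BalabanUVNodes.N15.Gluing (SfIdx sfGeo sfInstance sfInstance_reg335_iff CvX CvX' cvM cvBlk CvNorm cvNL cvNL' cvGlued cvGlued' cvNVq cvNVq' cvNVr cvNVr'
  l2_opNorm_le_frobenius_norm pow_sub_one_le_exp_sub_one)
open Summit.QuantumFields.YangMills.BalabanUVNodes.N15.GluedZeroField (exists_hasMaj_sfqr_sub_tensorId_gOp exists_hasMaj_idef_sfqr_sub_tensorId_gOp inv_le_rpow_neg_sixteenth)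
open Literature.NumberTheory.Sieve.SquarefreeSums (exp_sub_one_le_two_mul)

variable {d : ℕ} {L : ℕ} [NeZero L] {mm ι : Type} [Fintype mm] [DecidableEq mm] [Fintype ι] [DecidableEq ι] {a : ℝ} {e : Matrix mm mm ℂ ≃L[ℝ] (ι → ℝ)}

open scoped Matrix.Norms.L2Operator

set_option maxHeartbeats 800000 in
/-- ★★★ **dag-n15-c's (P-R) PROPAGATOR FAMILY `X_r` MEETS (𝟙P-c′)'s THREE DISPLAYED ROWS UNDER BAŁABAN's CLASS (3.35), GIVEN n15-c∕211's THREE GLOBAL LANDAU ROWS** (189b's threshold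
template, as (𝟙P-e″) `rows_sfq`): for odd `L ≥ 7`, `a, c₃₅ > 0`, trace-form coordinates `e`, `ι`, `mm` nonempty, and Landau letters `δ_R > 0`, `c_R, C_R ≥ 0`, `γ_R` with n15-c∕211's
`hG` body (`N_V^R(e^{ηĀ′}) ≤ c_R·r_A·e^{−δ_R d}` coarse, `N_V^R′(e^{η′A′}) ≤ c_R·r_A·e^{−δ_R d}` fine, `𝔇(N_V^R′, N_V^R) ≤ C_R·(L^k)^{−γ_R}·e^{−δ_R d}`, `r_A = c₃₅L^mα₀`, for every index
and every class field): there are `ρ_X > 0`, `K_X ≥ 0`, `w_X`, `s_X > 0` such that for every index `i`, every `α₀ > 0` with `L^m ≥ w_X`, `c₃₅L^mα₀ ≤ s_X` and every `A′` with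
`Reg335 c₃₅ α₀ A′`: `|X_r(A′) − G⊗1|, |X′_r(A′) − G′⊗1| ≤ K_X·(c₃₅L^mα₀)·e^{−ρ_X d}` and `|𝔇(X′_r(A′) − G′⊗1, X_r(A′) − G⊗1)| ≤ K_X·(L^k)^{−min(γ_R, 1∕16)}·e^{−ρ_X d}` — the (P-R) pair
(Bałaban's whole covariant summand live inside) in the shape (𝟙P-c′)∕(𝟙P-d′) consume at `γ_X = min γ_R (1∕16)`.  (t2) F3 (δ_e := δ_R) + F4 (δ_e := δ_R) under the class: FILE 130's
window letters from `Reg335` (189b), transporter sizes `≤ 4(d+2)Λ·r_A ≤ 1`, budgets met below `s_X`, 206's bracket `≤ (1 + C₁ + 2C_R)(L^k)^{−γ_X}`.  MODEL objects; the Landau rows are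
HYPOTHESES; NOT [B9] (3.62)–(3.65)∕Thm 3.4 as printed.
[cite: Balaban1985BackgroundPropagators, (3.35) p.396, (3.25)–(3.26) p.395, (3.49) p.398, (3.62)–(3.65) pp.402–403 (shape «G(U) − G(1) = O(field)»), Thm 3.4 p.400; King1986, Prop. 3.9 (3.73) p.665 (rate)] -/
theorem rows_sfqr [Nonempty ι] [Nonempty mm] (hL : Odd L ∧ 1 < L) (hL7 : 7 ≤ L) (ha : 0 < a) {c35 : ℝ} (hc35 : 0 < c35) (he : ∀ A B : Matrix mm mm ℂ, traceForm A B = e A ⬝ᵥ e B)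
    {δR cR CR γR : ℝ} (hδR : 0 < δR) (hcR : 0 ≤ cR) (hCR : 0 ≤ CR)
    (hG : ∀ i : SfIdx d L, ∀ α₀ : ℝ, 0 < α₀ → ∀ A' : Fin (d + 1) → CvX' d L i.m i.kk i.r hL → Matrix mm mm ℂ, (sfInstance d mm ι hL i).Bf.Reg335 c35 α₀ A' →
        HasMaj (CvNorm d L i.m i.kk hL ι) (CvNorm d L i.m i.kk hL ι) (cvNVr d L i.m i.kk hL a ι e (fun μ x => NormedSpace.exp (((((L ^ i.kk : ℕ) : ℝ))⁻¹) • gavgM (Matrix mm mm ℂ) (Fin (d + 1)) (kingPrV L i.kk i.r (cvM d L i.m i.kk hL)) A' μ x))) (fun y y' => (cR * (c35 * (L : ℝ) ^ i.m * α₀)) * Real.exp (-(δR * (unitTorusGeo L i.kk (cvM d L i.m i.kk hL)).dist y y'))) ∧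
        HasMaj (BlockNorm.ofBlocks (unitTorusGeo L i.kk (cvM d L i.m i.kk hL)) (liftBlk (cvBlk d L i.m i.kk hL ∘ (kingPrV L i.kk i.r (cvM d L i.m i.kk hL))) ι)) (BlockNorm.ofBlocks (unitTorusGeo L i.kk (cvM d L i.m i.kk hL)) (liftBlk (cvBlk d L i.m i.kk hL ∘ (kingPrV L i.kk i.r (cvM d L i.m i.kk hL))) ι)) (cvNVr' d L i.m i.kk i.r hL a ι e (fun μ x' => NormedSpace.exp (((((L ^ i.r * L ^ i.kk : ℕ) : ℝ))⁻¹) • A' μ x'))) (fun y y' => (cR * (c35 * (L : ℝ) ^ i.m * α₀)) * Real.exp (-(δR * (unitTorusGeo L i.kk (cvM d L i.m i.kk hL)).dist y y'))) ∧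
        HasMaj (CvNorm d L i.m i.kk hL ι) (BlockNorm.ofBlocks (unitTorusGeo L i.kk (cvM d L i.m i.kk hL)) (liftBlk (cvBlk d L i.m i.kk hL ∘ (kingPrV L i.kk i.r (cvM d L i.m i.kk hL))) ι)) (idef (pull (liftMap (kingPrV L i.kk i.r (cvM d L i.m i.kk hL)) ι)) (pull (liftMap (kingPrV L i.kk i.r (cvM d L i.m i.kk hL)) ι)) (cvNVr' d L i.m i.kk i.r hL a ι e (fun μ x' => NormedSpace.exp (((((L ^ i.r * L ^ i.kk : ℕ) : ℝ))⁻¹) • A' μ x'))) (cvNVr d L i.m i.kk hL a ι e (fun μ x => NormedSpace.exp (((((L ^ i.kk : ℕ) : ℝ))⁻¹) • gavgM (Matrix mm mm ℂ) (Fin (d + 1)) (kingPrV L i.kk i.r (cvM d L i.m i.kk hL)) A' μ x)))) (fun y y' => (CR * ((L : ℝ) ^ i.kk) ^ (-γR)) * Real.exp (-(δR * (unitTorusGeo L i.kk (cvM d L i.m i.kk hL)).dist y y')))) :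
    ∃ ρX KX wX sX : ℝ, 0 < ρX ∧ 0 ≤ KX ∧ 0 < sX ∧
      ∀ (i : SfIdx d L) (α₀ : ℝ) (A' : Fin (d + 1) → CvX' d L i.m i.kk i.r hL → Matrix mm mm ℂ), 0 < α₀ → wX ≤ ((L ^ i.m : ℕ) : ℝ) → c35 * (L : ℝ) ^ i.m * α₀ ≤ sX →
        (sfInstance d mm ι hL i).Bf.Reg335 c35 α₀ A' →
        HasMaj (CvNorm d L i.m i.kk hL ι) (CvNorm d L i.m i.kk hL ι) ((cvGlued d L i.m i.kk hL a ((((L ^ i.kk : ℕ) : ℝ))⁻¹) ι e (fun _ _ => (1 : Matrix mm mm ℂ)) (fun μ x => NormedSpace.exp (((((L ^ i.kk : ℕ) : ℝ))⁻¹) • gavgM (Matrix mm mm ℂ) (Fin (d + 1)) (kingPrV L i.kk i.r (cvM d L i.m i.kk hL)) A' μ x)) (cvNL d L i.m i.kk hL a ι - (cvNVq d L i.m i.kk hL a ι e (fun μ x => NormedSpace.exp (((((L ^ i.kk : ℕ) : ℝ))⁻¹) • gavgM (Matrix mm mm ℂ) (Fin (d + 1)) (kingPrV L i.kk i.r (cvM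 d L i.m i.kk hL)) A' μ x))) - (cvNVr d L i.m i.kk hL a ι e (fun μ x => NormedSpace.exp (((((L ^ i.kk : ℕ) : ℝ))⁻¹) • gavgM (Matrix mm mm ℂ) (Fin (d + 1)) (kingPrV L i.kk i.r (cvM d L i.m i.kk hL)) A' μ x)))) (fun _ => (cvNVq d L i.m i.kk hL a ι e (fun μ x => NormedSpace.exp (((((L ^ i.kk : ℕ) : ℝ))⁻¹) • gavgM (Matrix mm mm ℂ) (Fin (d + 1)) (kingPrV L i.kk i.r (cvM d L i.m i.kk hL)) A' μ x))) + (cvNVr d L i.m i.kk hL a ι e (fun μ x => NormedSpace.exp (((((L ^ i.kk : ℕ) : ℝ))⁻¹) • gavgM (Matrix mm mm ℂ) (Fin (d + 1)) (kingPrV L i.kk i.r (cvM d L i.m i.kk hL)) A' μ x))))) - tensorId ι (gOp (cvM d L i.m i.kk hL) (L ^ i.kk) a))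
          (fun y y' => KX * (c35 * (L : ℝ) ^ i.m * α₀) * Real.exp (-(ρX * (unitTorusGeo L i.kk (cvM d L i.m i.kk hL)).dist y y'))) ∧
        HasMaj (BlockNorm.ofBlocks (unitTorusGeo L i.kk (cvM d L i.m i.kk hL)) (liftBlk (fun b : CvX' d L i.m i.kk i.r hL => blockOf (L ^ i.r * L ^ i.kk) (cvM d L i.m i.kk hL) b.1) ι)) (BlockNorm.ofBlocks (unitTorusGeo L i.kk (cvM d L i.m i.kk hL)) (liftBlk (fun b : CvX' d L i.m i.kk i.r hL => blockOf (L ^ i.r * L ^ i.kk) (cvM d L i.m i.kk hL) b.1) ι)) ((cvGlued' d L i.m i.kk i.r hL a ((((L ^ i.r * L ^ i.kk : ℕ) : ℝ))⁻¹) ι e (fun _ _ => (1 : Matrix mm mm ℂ)) (fun μ x' => NormedSpace.exp (((((L ^ i.r * L ^ i.kk : ℕ) : ℝ))⁻¹) • A' μ x')) (cvNL' d L i.m i.kk i.r hL a ι - (cvNVq' d L i.m i.kk i.r hL a ι e (fun μ x' => NormedSpace.exp (((((L ^ i.r * L ^ i.kk : ℕ) : ℝ))⁻¹) • A' μ x')))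 - (cvNVr' d L i.m i.kk i.r hL a ι e (fun μ x' => NormedSpace.exp (((((L ^ i.r * L ^ i.kk : ℕ) : ℝ))⁻¹) • A' μ x')))) (fun _ => (cvNVq' d L i.m i.kk i.r hL a ι e (fun μ x' => NormedSpace.exp (((((L ^ i.r * L ^ i.kk : ℕ) : ℝ))⁻¹) • A' μ x'))) + (cvNVr' d L i.m i.kk i.r hL a ι e (fun μ x' => NormedSpace.exp (((((L ^ i.r * L ^ i.kk : ℕ) : ℝ))⁻¹) • A' μ x'))))) - tensorId ι (gOp (cvM d L i.m i.kk hL) (L ^ i.r * L ^ i.kk) a))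
          (fun y y' => KX * (c35 * (L : ℝ) ^ i.m * α₀) * Real.exp (-(ρX * (unitTorusGeo L i.kk (cvM d L i.m i.kk hL)).dist y y'))) ∧
        HasMaj (CvNorm d L i.m i.kk hL ι) (BlockNorm.ofBlocks (unitTorusGeo L i.kk (cvM d L i.m i.kk hL)) (liftBlk (fun b : CvX' d L i.m i.kk i.r hL => blockOf (L ^ i.r * L ^ i.kk) (cvM d L i.m i.kk hL) b.1) ι))
          (idef (pull (liftMap (kingPrV L i.kk i.r (cvM d L i.m i.kk hL)) ι)) (pull (liftMap (kingPrV L i.kk i.r (cvM d L i.m i.kk hL)) ι)) ((cvGlued' d L i.m i.kk i.r hL a ((((L ^ i.r * L ^ i.kk : ℕ) : ℝ))⁻¹) ι e (fun _ _ => (1 : Matrix mm mm ℂ)) (fun μ x' => NormedSpace.exp (((((L ^ i.r * L ^ i.kk : ℕ) : ℝ))⁻¹) • A' μ x')) (cvNL' d L i.m i.kk i.r hL a ι - (cvNVq' d L i.m i.kk i.r hL a ι e (fun μ x' => NormedSpace.exp (((((L ^ i.r * L ^ i.kk : ℕ) : ℝ))⁻¹) • A' μ x'))) - (cvNVr' d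 L i.m i.kk i.r hL a ι e (fun μ x' => NormedSpace.exp (((((L ^ i.r * L ^ i.kk : ℕ) : ℝ))⁻¹) • A' μ x')))) (fun _ => (cvNVq' d L i.m i.kk i.r hL a ι e (fun μ x' => NormedSpace.exp (((((L ^ i.r * L ^ i.kk : ℕ) : ℝ))⁻¹) • A' μ x'))) + (cvNVr' d L i.m i.kk i.r hL a ι e (fun μ x' => NormedSpace.exp (((((L ^ i.r * L ^ i.kk : ℕ) : ℝ))⁻¹) • A' μ x'))))) - tensorId ι (gOp (cvM d L i.m i.kk hL) (L ^ i.r * L ^ i.kk) a)) ((cvGlued d L i.m i.kk hL a ((((L ^ i.kk : ℕ) : ℝ))⁻¹) ι e (fun _ _ => (1 : Matrix mm mm ℂ)) (fun μ x => NormedSpace.exp (((((L ^ i.kk : ℕ) : ℝ))⁻¹) • gavgM (Matrix mm mm ℂ) (Fin (d + 1)) (kingPrV L i.kk i.r (cvM d L i.m i.kk hL)) A' μ x)) (cvNL d L i.m i.kk hL a ι - (cvNVq d L i.m i.kk hL a ι e (fun μ x => NormedSpace.exp (((((L ^ i.kk : ℕ) : ℝ))⁻¹) • gavgM (Matrix mm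 mm ℂ) (Fin (d + 1)) (kingPrV L i.kk i.r (cvM d L i.m i.kk hL)) A' μ x))) - (cvNVr d L i.m i.kk hL a ι e (fun μ x => NormedSpace.exp (((((L ^ i.kk : ℕ) : ℝ))⁻¹) • gavgM (Matrix mm mm ℂ) (Fin (d + 1)) (kingPrV L i.kk i.r (cvM d L i.m i.kk hL)) A' μ x)))) (fun _ => (cvNVq d L i.m i.kk hL a ι e (fun μ x => NormedSpace.exp (((((L ^ i.kk : ℕ) : ℝ))⁻¹) • gavgM (Matrix mm mm ℂ) (Fin (d + 1)) (kingPrV L i.kk i.r (cvM d L i.m i.kk hL)) A' μ x))) + (cvNVr d L i.m i.kk hL a ι e (fun μ x => NormedSpace.exp (((((L ^ i.kk : ℕ) : ℝ))⁻¹) • gavgM (Matrix mm mm ℂ) (Fin (d + 1)) (kingPrV L i.kk i.r (cvM d L i.m i.kk hL)) A' μ x))))) - tensorId ι (gOp (cvM d L i.m i.kk hL) (L ^ i.kk) a)))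
          (fun y y' => KX * ((((L ^ i.kk : ℕ) : ℝ)) ^ (-(min γR (1 / 16)))) * Real.exp (-(ρX * (unitTorusGeo L i.kk (cvM d L i.m i.kk hL)).dist y y'))) := by
  have hLpos : 0 < L := Nat.pos_of_ne_zero (NeZero.ne L)
  have hLr : (0 : ℝ) < (L : ℝ) := Nat.cast_pos.mpr hLpos
  have hL1 : (1 : ℝ) ≤ (L : ℝ) := by exact_mod_cast hLpos
  obtain ⟨δb, wb, Rb, θb, R1b, Kb, hδb, -, hRb, hθb, hR1b, hKb, Hb⟩ := exists_hasMaj_sfqr_sub_tensorId_gOp (d := d) hL hL7 ha ι hδR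
  obtain ⟨δc, wc, Rc, θc, R1c, Kc, hδc, -, hRc, hθc, hR1c, hKcpos, Hc⟩ := exists_hasMaj_idef_sfqr_sub_tensorId_gOp (d := d) hL hL7 ha ι hδR
  -- the constants (189b's)
  have hκ0 : 0 ≤ basisConst e := basisConst_nonneg e
  have hκF := @basisConst_nonneg ι _ (Matrix mm mm ℂ) Matrix.frobeniusNormedAddCommGroup Matrix.frobeniusNormedSpace e
  let σ : ℝ := 14 * Real.exp 1 * (1 + Fintype.card (Fin (d + 1))) * basisConst e * ((1 + Fintype.card (Fin (d + 1))) * (3 + 2 * ((d : ℝ) + 1)))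
  have hσ0 : 0 ≤ σ := by positivity
  let JJ : ℝ := 1 + Fintype.card (Fin (d + 1) ⊕ Fin (d + 1))
  have hJJ0 : 0 ≤ JJ := by positivity
  let W : ℝ := 2 * ((1 + Fintype.card (Fin (d + 1))) * (3 + 2 * ((d : ℝ) + 1)))
  have hW0 : 0 < W := by positivity
  have hW1 : 1 ≤ W := by
    show (1 : ℝ) ≤ 2 * ((1 + Fintype.card (Fin (d + 1))) * (3 + 2 * ((d : ℝ) + 1)))
    have h1 : (1 : ℝ) ≤ 1 + Fintype.card (Fin (d + 1)) := le_add_of_nonneg_right (Nat.cast_nonneg _)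
    have h2 : (1 : ℝ) ≤ 3 + 2 * ((d : ℝ) + 1) := by have := (Nat.cast_nonneg d : (0 : ℝ) ≤ d); linarith
    nlinarith
  let Λ : ℝ := (Fintype.card ι * (@basisConst ι _ (Matrix mm mm ℂ) Matrix.frobeniusNormedAddCommGroup Matrix.frobeniusNormedSpace e * (2 * Real.sqrt (Fintype.card mm)) * Real.sqrt (Fintype.card mm)))
  have hΛ0 : 0 ≤ Λ := by positivity
  let cΦ : ℝ := (3 ^ (d + 1) * (72 * ((d : ℝ) + 1) ^ 2 + 9 * ((d : ℝ) + 1)) + (2 + 2 * Real.exp 1 + 2 * Real.exp 1 ^ 2 * ((d : ℝ) + 1)))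
  have hcΦ0 : 0 ≤ cΦ := by positivity
  let G : ℝ := 8 * ((d : ℝ) + 2) * Λ
  have hG0 : 0 ≤ G := by positivity
  -- the window `s_X` on `r_A = c₃₅L^mα₀`
  let sW : ℝ := 1 / W
  let sK : ℝ := 1 / (4 * ((d : ℝ) + 2) * Λ + 1)
  let sRb : ℝ := Rb / (σ * JJ + R1b * G + cR + 1)
  let sθb : ℝ := θb / (R1b * G + cR + 1)
  let sRc : ℝ := Rc / (σ * JJ + R1c * G + cR + 1)
  let sθc : ℝ := θc / (R1c * G + cR + 1)
  let sX : ℝ := min (min sW sK) (min (min sRb sθb) (min sRc sθc))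
  have hsX : 0 < sX := lt_min (lt_min (by positivity) (by positivity)) (lt_min (lt_min (by positivity) (by positivity)) (lt_min (by positivity) (by positivity)))
  have hsW : sX ≤ sW := (min_le_left _ _).trans (min_le_left _ _)
  have hsK : sX ≤ sK := (min_le_left _ _).trans (min_le_right _ _)
  have hsRb : sX ≤ sRb := ((min_le_right _ _).trans (min_le_left _ _)).trans (min_le_left _ _)
  have hsθb : sX ≤ sθb := ((min_le_right _ _).trans (min_le_left _ _)).trans (min_le_right _ _)
  have hsRc : sX ≤ sRc := ((min_le_right _ _).trans (min_le_right _ _)).trans (min_le_left _ _)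
  have hsθc : sX ≤ sθc := ((min_le_right _ _).trans (min_le_right _ _)).trans (min_le_right _ _)
  let C₁ : ℝ := σ * sX * JJ + 2 * (R1c * (20 + 4 * (Λ * cΦ * sX)))
  have hC₁0 : 0 ≤ C₁ := by positivity
  refine ⟨min δb δc, max (Kb * (basisConst e + G + cR)) (Kc * (1 + C₁ + 2 * CR)), max wb wc, sX, lt_min hδb hδc, le_max_of_le_left (by positivity), hsX,
    fun i α₀ A' hα₀ hw hrS hA' => ?_⟩
  set M := cvM d L i.m i.kk hL with hMdef
  have hd := fun y y' => unitTorusGeo_dist_nonneg L i.kk M y y'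
  have hwb : wb ≤ ((L ^ i.m : ℕ) : ℝ) := (le_max_left _ _).trans hw
  have hwc : wc ≤ ((L ^ i.m : ℕ) : ℝ) := (le_max_right _ _).trans hw
  have hx1 : (1 : ℝ) ≤ (L : ℝ) ^ i.kk := one_le_pow₀ hL1
  have hxpos : (0 : ℝ) < (L : ℝ) ^ i.kk := pow_pos hLr _
  have hcast : (((L ^ i.kk : ℕ) : ℝ)) = (L : ℝ) ^ i.kk := by push_cast; rfl
  have hkpos : (0 : ℝ) < (((L ^ i.kk : ℕ) : ℝ)) := by rw [hcast]; exact hxpos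
  have hx1' : (1 : ℝ) ≤ (((L ^ i.kk : ℕ) : ℝ)) := by rw [hcast]; exact hx1
  have hθ0 : 0 ≤ (((L ^ i.kk : ℕ) : ℝ)) ^ (-(1 / 16 : ℝ)) := Real.rpow_nonneg hkpos.le _
  have hη0 : 0 ≤ ((((L ^ i.kk : ℕ) : ℝ)))⁻¹ := inv_nonneg.mpr hkpos.le
  have hηθ : ((((L ^ i.kk : ℕ) : ℝ)))⁻¹ ≤ (((L ^ i.kk : ℕ) : ℝ)) ^ (-(1 / 16 : ℝ)) := inv_le_rpow_neg_sixteenth hx1'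
  -- the class at the index: skewness and Frobenius letters ⟹ operator-norm letters
  obtain ⟨hskew, h1F, h2F, h3F⟩ := (sfInstance_reg335_iff d mm ι hL i c35 α₀ A').1 hA'
  have hconv : ((L : ℝ) ^ i.kk)⁻¹ * ((L : ℝ) ^ i.r)⁻¹ = ((((L ^ i.r * L ^ i.kk : ℕ) : ℝ))⁻¹) := by
    push_cast
    rw [mul_inv, mul_comm]
  have hrA0 : 0 ≤ (c35 * (L : ℝ) ^ i.m * α₀) := by positivity
  have h1 : ∀ μ x', ‖A' μ x'‖ ≤ (c35 * (L : ℝ) ^ i.m * α₀) := fun μ x' => (l2_opNorm_le_frobenius_norm _).trans (h1F μ x')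
  have h2' : ∀ μ κ x', ‖A' μ (bshiftEquiv (cvM d L i.m i.kk hL) (L ^ i.r * L ^ i.kk) κ x') - A' μ x'‖ ≤ (c35 * (L : ℝ) ^ i.m * α₀) * ((((L ^ i.r * L ^ i.kk : ℕ) : ℝ))⁻¹) :=
    fun μ κ x' => ((l2_opNorm_le_frobenius_norm _).trans (h2F μ κ x')).trans_eq (by rw [hconv])
  have h3' : ∀ μ κ x', ‖(A' μ (bshiftEquiv (cvM d L i.m i.kk hL) (L ^ i.r * L ^ i.kk) κ x') - A' μ x') -
      (A' μ (bshiftEquiv (cvM d L i.m i.kk hL) (L ^ i.r * L ^ i.kk) κ ((bshiftEquiv (cvM d L i.m i.kk hL) (L ^ i.r * L ^ i.kk) μ).symm x')) -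
        A' μ ((bshiftEquiv (cvM d L i.m i.kk hL) (L ^ i.r * L ^ i.kk) μ).symm x'))‖ ≤ (c35 * (L : ℝ) ^ i.m * α₀) * ((((L ^ i.r * L ^ i.kk : ℕ) : ℝ))⁻¹) * ((((L ^ i.r * L ^ i.kk : ℕ) : ℝ))⁻¹) :=
    fun μ κ x' => ((l2_opNorm_le_frobenius_norm _).trans (h3F μ κ x')).trans_eq (by rw [hconv])
  -- the Landau letters at the index (n15-c∕211's three global rows, rate `δ_R`)
  have hρR0 : 0 ≤ cR * (c35 * (L : ℝ) ^ i.m * α₀) := mul_nonneg hcR hrA0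
  have hoR0 : 0 ≤ CR * ((L : ℝ) ^ i.kk) ^ (-γR) := mul_nonneg hCR (Real.rpow_nonneg hxpos.le _)
  obtain ⟨g1, g2, g3⟩ := hG i α₀ hα₀ A' hA'
  have hxg0 : 0 ≤ (((L ^ i.kk : ℕ) : ℝ)) ^ (-(min γR (1 / 16))) := Real.rpow_nonneg hkpos.le _
  have h16g : (((L ^ i.kk : ℕ) : ℝ)) ^ (-(1 / 16 : ℝ)) ≤ (((L ^ i.kk : ℕ) : ℝ)) ^ (-(min γR (1 / 16))) := Real.rpow_le_rpow_of_exponent_le hx1' (neg_le_neg (min_le_right _ _))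
  have hηg : ((((L ^ i.kk : ℕ) : ℝ))⁻¹) ≤ (((L ^ i.kk : ℕ) : ℝ)) ^ (-(min γR (1 / 16))) := hηθ.trans h16g
  have hRg : ((L : ℝ) ^ i.kk) ^ (-γR) ≤ (((L ^ i.kk : ℕ) : ℝ)) ^ (-(min γR (1 / 16))) := by rw [hcast]; exact Real.rpow_le_rpow_of_exponent_le hx1 (neg_le_neg (min_le_left _ _))
  -- the window `W·r_A ≤ 1`, hence `r_A ≤ 1`
  have hrW : (c35 * (L : ℝ) ^ i.m * α₀) ≤ 1 / W := hrS.trans hsW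
  have hr2 : 2 * ((1 + Fintype.card (Fin (d + 1))) * ((3 + 2 * ((d : ℝ) + 1)) * (c35 * (L : ℝ) ^ i.m * α₀))) ≤ 1 := by
    calc 2 * ((1 + Fintype.card (Fin (d + 1))) * ((3 + 2 * ((d : ℝ) + 1)) * (c35 * (L : ℝ) ^ i.m * α₀))) = W * (c35 * (L : ℝ) ^ i.m * α₀) := by ring
      _ ≤ W * (1 / W) := mul_le_mul_of_nonneg_left hrW hW0.le
      _ = 1 := by field_simp
  have hrA1 : (c35 * (L : ℝ) ^ i.m * α₀) ≤ 1 := hrW.trans ((div_le_one hW0).mpr hW1)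
  -- the transporter sizes `K_c, K_f ≤ 4(d+2)Λ·r_A ≤ 1`
  have hKr : 4 * ((d : ℝ) + 2) * Λ * (c35 * (L : ℝ) ^ i.m * α₀) ≤ 1 := by
    have hden : 0 < 4 * ((d : ℝ) + 2) * Λ + 1 := by positivity
    calc 4 * ((d : ℝ) + 2) * Λ * (c35 * (L : ℝ) ^ i.m * α₀) ≤ 4 * ((d : ℝ) + 2) * Λ * (1 / (4 * ((d : ℝ) + 2) * Λ + 1)) := mul_le_mul_of_nonneg_left (hrS.trans hsK) (by positivity)
      _ = (4 * ((d : ℝ) + 2) * Λ) / (4 * ((d : ℝ) + 2) * Λ + 1) := by ring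
      _ ≤ 1 := (div_le_one hden).mpr (by linarith)
  have hx2 : 0 ≤ 2 * ((d : ℝ) + 2) * Λ * (c35 * (L : ℝ) ^ i.m * α₀) := by positivity
  have hx2' : 2 * ((d : ℝ) + 2) * Λ * (c35 * (L : ℝ) ^ i.m * α₀) ≤ 1 := by linarith
  have hKc : ((1 + Fintype.card ι * (@basisConst ι _ (Matrix mm mm ℂ) Matrix.frobeniusNormedAddCommGroup Matrix.frobeniusNormedSpace e * (2 * Real.sqrt (Fintype.card mm)) * (Real.sqrt (Fintype.card mm) * (2 * ((c35 * (L : ℝ) ^ i.m * α₀) * ((((L ^ i.kk : ℕ) : ℝ))⁻¹)))))) ^ ((d + 2) * L ^ i.kk) - 1) ≤ 4 * ((d : ℝ) + 2) * Λ * (c35 * (L : ℝ) ^ i.m * α₀) := by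
    have hy0 : 0 ≤ Fintype.card ι * (@basisConst ι _ (Matrix mm mm ℂ) Matrix.frobeniusNormedAddCommGroup Matrix.frobeniusNormedSpace e * (2 * Real.sqrt (Fintype.card mm)) * (Real.sqrt (Fintype.card mm) * (2 * ((c35 * (L : ℝ) ^ i.m * α₀) * ((((L ^ i.kk : ℕ) : ℝ))⁻¹))))) := by positivity
    refine (pow_sub_one_le_exp_sub_one hy0 _).trans ?_
    have hexp : Fintype.card ι * (@basisConst ι _ (Matrix mm mm ℂ) Matrix.frobeniusNormedAddCommGroup Matrix.frobeniusNormedSpace e * (2 * Real.sqrt (Fintype.card mm)) * (Real.sqrt (Fintype.card mm) * (2 * ((c35 * (L : ℝ) ^ i.m * α₀) * ((((L ^ i.kk : ℕ) : ℝ))⁻¹))))) * (((d + 2) * L ^ i.kk : ℕ) : ℝ) = 2 * ((d : ℝ) + 2) * Λ * (c35 * (L : ℝ) ^ i.m * α₀) := by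
      have hk0 : (((L ^ i.kk : ℕ) : ℝ)) ≠ 0 := by rw [hcast]; exact hxpos.ne'
      push_cast
      field_simp
      ring
    rw [hexp]
    have h := exp_sub_one_le_two_mul hx2 hx2'
    linarith
  have hKf : ((1 + Fintype.card ι * (@basisConst ι _ (Matrix mm mm ℂ) Matrix.frobeniusNormedAddCommGroup Matrix.frobeniusNormedSpace e * (2 * Real.sqrt (Fintype.card mm)) * (Real.sqrt (Fintype.card mm) * (2 * ((c35 * (L : ℝ) ^ i.m * α₀) * ((((L ^ i.r * L ^ i.kk : ℕ) : ℝ))⁻¹)))))) ^ ((d + 2) * (L ^ i.r * L ^ i.kk)) - 1) ≤ 4 * ((d : ℝ) + 2) * Λ * (c35 * (L : ℝ) ^ i.m * α₀) := by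
    have hy0 : 0 ≤ Fintype.card ι * (@basisConst ι _ (Matrix mm mm ℂ) Matrix.frobeniusNormedAddCommGroup Matrix.frobeniusNormedSpace e * (2 * Real.sqrt (Fintype.card mm)) * (Real.sqrt (Fintype.card mm) * (2 * ((c35 * (L : ℝ) ^ i.m * α₀) * ((((L ^ i.r * L ^ i.kk : ℕ) : ℝ))⁻¹))))) := by positivity
    refine (pow_sub_one_le_exp_sub_one hy0 _).trans ?_
    have hexp : Fintype.card ι * (@basisConst ι _ (Matrix mm mm ℂ) Matrix.frobeniusNormedAddCommGroup Matrix.frobeniusNormedSpace e * (2 * Real.sqrt (Fintype.card mm)) * (Real.sqrt (Fintype.card mm) * (2 * ((c35 * (L : ℝ) ^ i.m * α₀) * ((((L ^ i.r * L ^ i.kk : ℕ) : ℝ))⁻¹))))) * (((d + 2) * (L ^ i.r * L ^ i.kk) : ℕ) : ℝ) = 2 * ((d : ℝ) + 2) * Λ * (c35 * (L : ℝ) ^ i.m * α₀) := by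
      have hk0 : (((L ^ i.r * L ^ i.kk : ℕ) : ℝ)) ≠ 0 := Nat.cast_ne_zero.mpr (Nat.pos_iff_ne_zero.mp (Nat.mul_pos (pow_pos hLpos _) (pow_pos hLpos _)))
      field_simp
      push_cast
      ring
    rw [hexp]
    have h := exp_sub_one_le_two_mul hx2 hx2'
    linarith
  have hKc1 : ((1 + Fintype.card ι * (@basisConst ι _ (Matrix mm mm ℂ) Matrix.frobeniusNormedAddCommGroup Matrix.frobeniusNormedSpace e * (2 * Real.sqrt (Fintype.card mm)) * (Real.sqrt (Fintype.card mm) * (2 * ((c35 * (L : ℝ) ^ i.m * α₀) * ((((L ^ i.kk : ℕ) : ℝ))⁻¹)))))) ^ ((d + 2) * L ^ i.kk) - 1) ≤ 1 := hKc.trans hKr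
  have hKf1 : ((1 + Fintype.card ι * (@basisConst ι _ (Matrix mm mm ℂ) Matrix.frobeniusNormedAddCommGroup Matrix.frobeniusNormedSpace e * (2 * Real.sqrt (Fintype.card mm)) * (Real.sqrt (Fintype.card mm) * (2 * ((c35 * (L : ℝ) ^ i.m * α₀) * ((((L ^ i.r * L ^ i.kk : ℕ) : ℝ))⁻¹)))))) ^ ((d + 2) * (L ^ i.r * L ^ i.kk)) - 1) ≤ 1 := hKf.trans hKr
  have hKC0 : 0 ≤ ((1 + Fintype.card ι * (@basisConst ι _ (Matrix mm mm ℂ) Matrix.frobeniusNormedAddCommGroup Matrix.frobeniusNormedSpace e * (2 * Real.sqrt (Fintype.card mm)) * (Real.sqrt (Fintype.card mm) * (2 * ((c35 * (L : ℝ) ^ i.m * α₀) * ((((L ^ i.kk : ℕ) : ℝ))⁻¹)))))) ^ ((d + 2) * L ^ i.kk) - 1) := by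
    have := one_le_pow₀ (M₀ := ℝ) (a := 1 + Fintype.card ι * (@basisConst ι _ (Matrix mm mm ℂ) Matrix.frobeniusNormedAddCommGroup Matrix.frobeniusNormedSpace e * (2 * Real.sqrt (Fintype.card mm)) * (Real.sqrt (Fintype.card mm) * (2 * ((c35 * (L : ℝ) ^ i.m * α₀) * ((((L ^ i.kk : ℕ) : ℝ))⁻¹)))))) (by linarith [show (0:ℝ) ≤ Fintype.card ι * (@basisConst ι _ (Matrix mm mm ℂ) Matrix.frobeniusNormedAddCommGroup Matrix.frobeniusNormedSpace e * (2 * Real.sqrt (Fintype.card mm)) * (Real.sqrt (Fintype.card mm) * (2 * ((c35 * (L : ℝ) ^ i.m * α₀) * ((((L ^ i.kk : ℕ) : ℝ))⁻¹))))) by positivity]) (n := (d + 2) * L ^ i.kk); linarith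
  have hKF0 : 0 ≤ ((1 + Fintype.card ι * (@basisConst ι _ (Matrix mm mm ℂ) Matrix.frobeniusNormedAddCommGroup Matrix.frobeniusNormedSpace e * (2 * Real.sqrt (Fintype.card mm)) * (Real.sqrt (Fintype.card mm) * (2 * ((c35 * (L : ℝ) ^ i.m * α₀) * ((((L ^ i.r * L ^ i.kk : ℕ) : ℝ))⁻¹)))))) ^ ((d + 2) * (L ^ i.r * L ^ i.kk)) - 1) := by
    have := one_le_pow₀ (M₀ := ℝ) (a := 1 + Fintype.card ι * (@basisConst ι _ (Matrix mm mm ℂ) Matrix.frobeniusNormedAddCommGroup Matrix.frobeniusNormedSpace e * (2 * Real.sqrt (Fintype.card mm)) * (Real.sqrt (Fintype.card mm) * (2 * ((c35 * (L : ℝ) ^ i.m * α₀) * ((((L ^ i.r * L ^ i.kk : ℕ) : ℝ))⁻¹)))))) (by linarith [show (0:ℝ) ≤ Fintype.card ι * (@basisConst ι _ (Matrix mm mm ℂ) Matrix.frobeniusNormedAddCommGroup Matrix.frobeniusNormedSpace e * (2 * Real.sqrt (Fintype.card mm)) * (Real.sqrt (Fintype.card mm) * (2 * ((c35 * (L : ℝ)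 ^ i.m * α₀) * ((((L ^ i.r * L ^ i.kk : ℕ) : ℝ))⁻¹))))) by positivity]) (n := (d + 2) * (L ^ i.r * L ^ i.kk)); linarith
  have hKsum : ((1 + Fintype.card ι * (@basisConst ι _ (Matrix mm mm ℂ) Matrix.frobeniusNormedAddCommGroup Matrix.frobeniusNormedSpace e * (2 * Real.sqrt (Fintype.card mm)) * (Real.sqrt (Fintype.card mm) * (2 * ((c35 * (L : ℝ) ^ i.m * α₀) * ((((L ^ i.kk : ℕ) : ℝ))⁻¹)))))) ^ ((d + 2) * L ^ i.kk) - 1) + ((1 + Fintype.card ι * (@basisConst ι _ (Matrix mm mm ℂ) Matrix.frobeniusNormedAddCommGroup Matrix.frobeniusNormedSpace e * (2 * Real.sqrt (Fintype.card mm)) * (Real.sqrt (Fintype.card mm) * (2 * ((c35 * (L : ℝ) ^ i.m * α₀) * ((((L ^ i.r * L ^ i.kk : ℕ) : ℝ))⁻¹)))))) ^ ((d + 2) * (L ^ i.r * L ^ i.kk)) - 1) ≤ G * (c35 * (L : ℝ) ^ i.m * α₀) := by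
    show ((1 + Fintype.card ι * (@basisConst ι _ (Matrix mm mm ℂ) Matrix.frobeniusNormedAddCommGroup Matrix.frobeniusNormedSpace e * (2 * Real.sqrt (Fintype.card mm)) * (Real.sqrt (Fintype.card mm) * (2 * ((c35 * (L : ℝ) ^ i.m * α₀) * ((((L ^ i.kk : ℕ) : ℝ))⁻¹)))))) ^ ((d + 2) * L ^ i.kk) - 1) + ((1 + Fintype.card ι * (@basisConst ι _ (Matrix mm mm ℂ) Matrix.frobeniusNormedAddCommGroup Matrix.frobeniusNormedSpace e * (2 * Real.sqrt (Fintype.card mm)) * (Real.sqrt (Fintype.card mm) * (2 * ((c35 * (L : ℝ) ^ i.m * α₀) * ((((L ^ i.r * L ^ i.kk : ℕ) : ℝ))⁻¹)))))) ^ ((d + 2) * (L ^ i.r * L ^ i.kk)) - 1) ≤ 8 * ((d : ℝ) + 2) * Λ * (c35 * (L : ℝ) ^ i.m * α₀)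
    linarith
  -- the scale conditions of F2∕206 (with either `R₁`), the Landau size letter `c_R·r_A` inside both budgets
  have hscale : (14 * Real.exp 1 * (1 + Fintype.card (Fin (d + 1))) * basisConst e * ((1 + Fintype.card (Fin (d + 1))) * ((3 + 2 * ((d : ℝ) + 1)) * (c35 * (L : ℝ) ^ i.m * α₀)))) = σ * (c35 * (L : ℝ) ^ i.m * α₀) := by ring
  have hRθ : ∀ (R₀ R₁ : ℝ), 0 < R₀ → 0 < R₁ → (c35 * (L : ℝ) ^ i.m * α₀) ≤ R₀ / (σ * JJ + R₁ * G + cR + 1) →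
      (14 * Real.exp 1 * (1 + Fintype.card (Fin (d + 1))) * basisConst e * ((1 + Fintype.card (Fin (d + 1))) * ((3 + 2 * ((d : ℝ) + 1)) * (c35 * (L : ℝ) ^ i.m * α₀)))) * (1 + Fintype.card (Fin (d + 1) ⊕ Fin (d + 1))) + R₁ * (((1 + Fintype.card ι * (@basisConst ι _ (Matrix mm mm ℂ) Matrix.frobeniusNormedAddCommGroup Matrix.frobeniusNormedSpace e * (2 * Real.sqrt (Fintype.card mm)) * (Real.sqrt (Fintype.card mm) * (2 * ((c35 * (L : ℝ) ^ i.m * α₀) * ((((L ^ i.kk : ℕ) : ℝ))⁻¹)))))) ^ ((d + 2) * L ^ i.kk) - 1) + ((1 + Fintype.card ι * (@basisConst ι _ (Matrix mm mm ℂ) Matrix.frobeniusNormedAddCommGroup Matrix.frobeniusNormedSpace e * (2 * Real.sqrt (Fintype.card mm)) * (Real.sqrt (Fintype.card mm) * (2 * ((c35 * (L : ℝ) ^ i.m * α₀) * ((((L ^ i.r * L ^ i.kk : ℕ) : ℝ))⁻¹)))))) ^ ((d + 2) * (L ^ i.r * L ^ i.kk)) - 1)) + cR * (c35 * (L : ℝ)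 ^ i.m * α₀) ≤ R₀ := fun R₀ R₁ hR₀ hR₁ hr => by
    rw [hscale]
    have hden : 0 < σ * JJ + R₁ * G + cR + 1 := by positivity
    calc σ * (c35 * (L : ℝ) ^ i.m * α₀) * (1 + Fintype.card (Fin (d + 1) ⊕ Fin (d + 1))) + R₁ * (((1 + Fintype.card ι * (@basisConst ι _ (Matrix mm mm ℂ) Matrix.frobeniusNormedAddCommGroup Matrix.frobeniusNormedSpace e * (2 * Real.sqrt (Fintype.card mm)) * (Real.sqrt (Fintype.card mm) * (2 * ((c35 * (L : ℝ) ^ i.m * α₀) * ((((L ^ i.kk : ℕ) : ℝ))⁻¹)))))) ^ ((d + 2) * L ^ i.kk) - 1) + ((1 + Fintype.card ι * (@basisConst ι _ (Matrix mm mm ℂ) Matrix.frobeniusNormedAddCommGroup Matrix.frobeniusNormedSpace e * (2 * Real.sqrt (Fintype.card mm)) * (Real.sqrt (Fintype.card mm) * (2 * ((c35 * (L : ℝ) ^ i.m * α₀) * ((((L ^ i.r * L ^ i.kk : ℕ) : ℝ))⁻¹)))))) ^ ((d + 2) * (L ^ i.r * L ^ i.kk)) - 1)) + cR * (c35 * (L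 : ℝ) ^ i.m * α₀) ≤ σ * (c35 * (L : ℝ) ^ i.m * α₀) * (1 + Fintype.card (Fin (d + 1) ⊕ Fin (d + 1))) + R₁ * (G * (c35 * (L : ℝ) ^ i.m * α₀)) + cR * (c35 * (L : ℝ) ^ i.m * α₀) :=
          add_le_add (add_le_add le_rfl (mul_le_mul_of_nonneg_left hKsum hR₁.le)) le_rfl
      _ = (σ * JJ + R₁ * G + cR) * (c35 * (L : ℝ) ^ i.m * α₀) := by
          show σ * (c35 * (L : ℝ) ^ i.m * α₀) * JJ + R₁ * (G * (c35 * (L : ℝ) ^ i.m * α₀)) + cR * (c35 * (L : ℝ) ^ i.m * α₀) = (σ * JJ + R₁ * G + cR) * (c35 * (L : ℝ) ^ i.m * α₀)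
          ring
      _ ≤ (σ * JJ + R₁ * G + cR) * (R₀ / (σ * JJ + R₁ * G + cR + 1)) := mul_le_mul_of_nonneg_left hr (by positivity)
      _ = R₀ * ((σ * JJ + R₁ * G + cR) / (σ * JJ + R₁ * G + cR + 1)) := by ring
      _ ≤ R₀ * 1 := mul_le_mul_of_nonneg_left ((div_le_one hden).mpr (by linarith)) hR₀.le
      _ = R₀ := mul_one _
  have hθ' : ∀ (θ₀ R₁ : ℝ), 0 < θ₀ → 0 < R₁ → (c35 * (L : ℝ) ^ i.m * α₀) ≤ θ₀ / (R₁ * G + cR + 1) → R₁ * (((1 + Fintype.card ι * (@basisConst ι _ (Matrix mm mm ℂ) Matrix.frobeniusNormedAddCommGroup Matrix.frobeniusNormedSpace e * (2 * Real.sqrt (Fintype.card mm)) * (Real.sqrt (Fintype.card mm) * (2 * ((c35 * (L : ℝ) ^ i.m * α₀) * ((((L ^ i.kk : ℕ) : ℝ))⁻¹)))))) ^ ((d + 2) * L ^ i.kk) - 1) + ((1 + Fintype.card ι * (@basisConst ι _ (Matrix mm mm ℂ) Matrix.frobeniusNormedAddCommGroup Matrix.frobeniusNormedSpace e * (2 *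 Real.sqrt (Fintype.card mm)) * (Real.sqrt (Fintype.card mm) * (2 * ((c35 * (L : ℝ) ^ i.m * α₀) * ((((L ^ i.r * L ^ i.kk : ℕ) : ℝ))⁻¹)))))) ^ ((d + 2) * (L ^ i.r * L ^ i.kk)) - 1)) + cR * (c35 * (L : ℝ) ^ i.m * α₀) ≤ θ₀ := fun θ₀ R₁ hθ₀ hR₁ hr => by
    have hden : 0 < R₁ * G + cR + 1 := by positivity
    calc R₁ * (((1 + Fintype.card ι * (@basisConst ι _ (Matrix mm mm ℂ) Matrix.frobeniusNormedAddCommGroup Matrix.frobeniusNormedSpace e * (2 * Real.sqrt (Fintype.card mm)) * (Real.sqrt (Fintype.card mm) * (2 * ((c35 * (L : ℝ) ^ i.m * α₀) * ((((L ^ i.kk : ℕ) : ℝ))⁻¹)))))) ^ ((d + 2) * L ^ i.kk) - 1) + ((1 + Fintype.card ι * (@basisConst ι _ (Matrix mm mm ℂ) Matrix.frobeniusNormedAddCommGroup Matrix.frobeniusNormedSpace e * (2 * Real.sqrt (Fintype.card mm)) * (Real.sqrt (Fintype.card mm) * (2 * ((c35 * (L : ℝ) ^ i.m * α₀) * ((((L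 ^ i.r * L ^ i.kk : ℕ) : ℝ))⁻¹)))))) ^ ((d + 2) * (L ^ i.r * L ^ i.kk)) - 1)) + cR * (c35 * (L : ℝ) ^ i.m * α₀) ≤ R₁ * (G * (c35 * (L : ℝ) ^ i.m * α₀)) + cR * (c35 * (L : ℝ) ^ i.m * α₀) := add_le_add (mul_le_mul_of_nonneg_left hKsum hR₁.le) le_rfl
      _ = (R₁ * G + cR) * (c35 * (L : ℝ) ^ i.m * α₀) := by ring
      _ ≤ (R₁ * G + cR) * (θ₀ / (R₁ * G + cR + 1)) := mul_le_mul_of_nonneg_left hr (by positivity)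
      _ = θ₀ * ((R₁ * G + cR) / (R₁ * G + cR + 1)) := by ring
      _ ≤ θ₀ * 1 := mul_le_mul_of_nonneg_left ((div_le_one hden).mpr (by linarith)) hθ₀.le
      _ = θ₀ := mul_one _
  have hRle_b := hRθ Rb R1b hRb hR1b (hrS.trans hsRb)
  have hθle_b := hθ' θb R1b hθb hR1b (hrS.trans hsθb)
  have hRle_c := hRθ Rc R1c hRc hR1c (hrS.trans hsRc)
  have hθle_c := hθ' θc R1c hθc hR1c (hrS.trans hsθc)
  -- the two landed letters at this index ((t2) F3 and F4)
  obtain ⟨hb, hb'⟩ := Hb i.m i.kk i.r i.one_le hwb e he A' hskew (c35 * (L : ℝ) ^ i.m * α₀) hrA0 hrA1 h1 h2' h3' hr2 (cR * (c35 * (L : ℝ) ^ i.m * α₀)) hρR0 hRle_b hθle_b hKc1 hKf1 g1 g2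
  have hc := Hc i.m i.kk i.r i.one_le hwc e he A' hskew (c35 * (L : ℝ) ^ i.m * α₀) hrA0 hrA1 h1 h2' h3' hr2 (cR * (c35 * (L : ℝ) ^ i.m * α₀)) (CR * ((L : ℝ) ^ i.kk) ^ (-γR)) hρR0 hoR0 hRle_c hθle_c hKc1 hKf1 g1 g2 g3
  -- the amplitudes: size `K_b(κ_e r_A + K_c + K_f + c_R r_A) ≤ K_b(κ_e + G + c_R) r_A`; defect `K_c·[bracket] ≤ K_c(1 + C₁ + 2C_R)(L^k)^{−γ_X}`
  have hsize : Kb * (basisConst e * (c35 * (L : ℝ) ^ i.m * α₀) + (((1 + Fintype.card ι * (@basisConst ι _ (Matrix mm mm ℂ) Matrix.frobeniusNormedAddCommGroup Matrix.frobeniusNormedSpace e * (2 * Real.sqrt (Fintype.card mm)) * (Real.sqrt (Fintype.card mm) * (2 * ((c35 * (L : ℝ) ^ i.m * α₀) * ((((L ^ i.kk : ℕ) : ℝ))⁻¹)))))) ^ ((d + 2) * L ^ i.kk) - 1) + ((1 + Fintype.card ι * (@basisConst ι _ (Matrix mm mm ℂ) Matrix.frobeniusNormedAddCommGroup Matrix.frobeniusNormedSpace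 e * (2 * Real.sqrt (Fintype.card mm)) * (Real.sqrt (Fintype.card mm) * (2 * ((c35 * (L : ℝ) ^ i.m * α₀) * ((((L ^ i.r * L ^ i.kk : ℕ) : ℝ))⁻¹)))))) ^ ((d + 2) * (L ^ i.r * L ^ i.kk)) - 1)) + cR * (c35 * (L : ℝ) ^ i.m * α₀)) ≤ max (Kb * (basisConst e + G + cR)) (Kc * (1 + C₁ + 2 * CR)) * (c35 * (L : ℝ) ^ i.m * α₀) := by
    calc Kb * (basisConst e * (c35 * (L : ℝ) ^ i.m * α₀) + (((1 + Fintype.card ι * (@basisConst ι _ (Matrix mm mm ℂ) Matrix.frobeniusNormedAddCommGroup Matrix.frobeniusNormedSpace e * (2 * Real.sqrt (Fintype.card mm)) * (Real.sqrt (Fintype.card mm) * (2 * ((c35 * (L : ℝ) ^ i.m * α₀) * ((((L ^ i.kk : ℕ) : ℝ))⁻¹)))))) ^ ((d + 2) * L ^ i.kk) - 1) + ((1 + Fintype.card ι * (@basisConst ι _ (Matrix mm mm ℂ) Matrix.frobeniusNormedAddCommGroup Matrix.frobeniusNormedSpace e * (2 * Real.sqrt (Fintype.card mm)) * (Real.sqrt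 (Fintype.card mm) * (2 * ((c35 * (L : ℝ) ^ i.m * α₀) * ((((L ^ i.r * L ^ i.kk : ℕ) : ℝ))⁻¹)))))) ^ ((d + 2) * (L ^ i.r * L ^ i.kk)) - 1)) + cR * (c35 * (L : ℝ) ^ i.m * α₀)) ≤ Kb * (basisConst e * (c35 * (L : ℝ) ^ i.m * α₀) + G * (c35 * (L : ℝ) ^ i.m * α₀) + cR * (c35 * (L : ℝ) ^ i.m * α₀)) := mul_le_mul_of_nonneg_left (by linarith [hKsum]) hKb.le
      _ = (Kb * (basisConst e + G + cR)) * (c35 * (L : ℝ) ^ i.m * α₀) := by ring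
      _ ≤ max (Kb * (basisConst e + G + cR)) (Kc * (1 + C₁ + 2 * CR)) * (c35 * (L : ℝ) ^ i.m * α₀) := mul_le_mul_of_nonneg_right (le_max_left _ _) hrA0
  have hbr : ((((L ^ i.kk : ℕ) : ℝ)) ^ (-(1 / 16 : ℝ)) + ((14 * Real.exp 1 * (1 + Fintype.card (Fin (d + 1))) * basisConst e * ((1 + Fintype.card (Fin (d + 1))) * ((3 + 2 * ((d : ℝ) + 1)) * (c35 * (L : ℝ) ^ i.m * α₀)))) * (1 + Fintype.card (Fin (d + 1) ⊕ Fin (d + 1))) * ((((L ^ i.kk : ℕ) : ℝ))⁻¹) + 2 * (R1c * (20 * ((((L ^ i.kk : ℕ) : ℝ))⁻¹) + 4 * Fintype.card ι * (@basisConst ι _ (Matrix mm mm ℂ) Matrix.frobeniusNormedAddCommGroup Matrix.frobeniusNormedSpace e * (2 * Real.sqrt (Fintype.card mm)) * (Real.sqrt (Fintype.card mm) * ((3 ^ (d + 1) * (72 * ((d : ℝ) + 1) ^ 2 + 9 * ((d : ℝ) + 1)) + (2 + 2 * Real.exp 1 + 2 * Real.exp 1 ^ 2 * ((d : ℝ)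 + 1))) * ((c35 * (L : ℝ) ^ i.m * α₀) * ((((L ^ i.kk : ℕ) : ℝ))⁻¹))))))) + ((CR * ((L : ℝ) ^ i.kk) ^ (-γR)) + (CR * ((L : ℝ) ^ i.kk) ^ (-γR))))) ≤ (1 + C₁ + 2 * CR) * (((L ^ i.kk : ℕ) : ℝ)) ^ (-(min γR (1 / 16))) := by
    have hre : ((14 * Real.exp 1 * (1 + Fintype.card (Fin (d + 1))) * basisConst e * ((1 + Fintype.card (Fin (d + 1))) * ((3 + 2 * ((d : ℝ) + 1)) * (c35 * (L : ℝ) ^ i.m * α₀)))) * (1 + Fintype.card (Fin (d + 1) ⊕ Fin (d + 1))) * ((((L ^ i.kk : ℕ) : ℝ))⁻¹) + 2 * (R1c * (20 * ((((L ^ i.kk : ℕ) : ℝ))⁻¹) + 4 * Fintype.card ι * (@basisConst ι _ (Matrix mm mm ℂ) Matrix.frobeniusNormedAddCommGroup Matrix.frobeniusNormedSpace e * (2 * Real.sqrt (Fintype.card mm)) * (Real.sqrt (Fintype.card mm) * ((3 ^ (d + 1) * (72 * ((d : ℝ) + 1) ^ 2 + 9 * ((d : ℝ) + 1)) + (2 +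 2 * Real.exp 1 + 2 * Real.exp 1 ^ 2 * ((d : ℝ) + 1))) * ((c35 * (L : ℝ) ^ i.m * α₀) * ((((L ^ i.kk : ℕ) : ℝ))⁻¹))))))) + ((CR * ((L : ℝ) ^ i.kk) ^ (-γR)) + (CR * ((L : ℝ) ^ i.kk) ^ (-γR)))) =
        (σ * (c35 * (L : ℝ) ^ i.m * α₀) * JJ + 2 * (R1c * (20 + 4 * (Λ * cΦ * (c35 * (L : ℝ) ^ i.m * α₀))))) * ((((L ^ i.kk : ℕ) : ℝ))⁻¹) + 2 * (CR * ((L : ℝ) ^ i.kk) ^ (-γR)) := by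
      show _ = (σ * (c35 * (L : ℝ) ^ i.m * α₀) * (1 + Fintype.card (Fin (d + 1) ⊕ Fin (d + 1))) + 2 * (R1c * (20 + 4 * ((Fintype.card ι * (@basisConst ι _ (Matrix mm mm ℂ) Matrix.frobeniusNormedAddCommGroup Matrix.frobeniusNormedSpace e * (2 * Real.sqrt (Fintype.card mm)) * Real.sqrt (Fintype.card mm))) * (3 ^ (d + 1) * (72 * ((d : ℝ) + 1) ^ 2 + 9 * ((d : ℝ) + 1)) + (2 + 2 * Real.exp 1 + 2 * Real.exp 1 ^ 2 * ((d : ℝ) + 1))) * (c35 * (L : ℝ) ^ i.m * α₀))))) * ((((L ^ i.kk : ℕ) : ℝ))⁻¹) + 2 * (CR * ((L : ℝ) ^ i.kk) ^ (-γR))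
      ring
    have hC₁le : σ * (c35 * (L : ℝ) ^ i.m * α₀) * JJ + 2 * (R1c * (20 + 4 * (Λ * cΦ * (c35 * (L : ℝ) ^ i.m * α₀)))) ≤ C₁ := by
      show σ * (c35 * (L : ℝ) ^ i.m * α₀) * JJ + 2 * (R1c * (20 + 4 * (Λ * cΦ * (c35 * (L : ℝ) ^ i.m * α₀)))) ≤ σ * sX * JJ + 2 * (R1c * (20 + 4 * (Λ * cΦ * sX)))
      have h4 : Λ * cΦ * (c35 * (L : ℝ) ^ i.m * α₀) ≤ Λ * cΦ * sX := mul_le_mul_of_nonneg_left hrS (mul_nonneg hΛ0 hcΦ0)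
      have h5 : R1c * (20 + 4 * (Λ * cΦ * (c35 * (L : ℝ) ^ i.m * α₀))) ≤ R1c * (20 + 4 * (Λ * cΦ * sX)) := mul_le_mul_of_nonneg_left (by linarith) hR1c.le
      have h6 : σ * (c35 * (L : ℝ) ^ i.m * α₀) * JJ ≤ σ * sX * JJ := mul_le_mul_of_nonneg_right (mul_le_mul_of_nonneg_left hrS hσ0) hJJ0
      linarith
    have hco0 : 0 ≤ σ * (c35 * (L : ℝ) ^ i.m * α₀) * JJ + 2 * (R1c * (20 + 4 * (Λ * cΦ * (c35 * (L : ℝ) ^ i.m * α₀)))) := by positivity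
    have hB : (σ * (c35 * (L : ℝ) ^ i.m * α₀) * JJ + 2 * (R1c * (20 + 4 * (Λ * cΦ * (c35 * (L : ℝ) ^ i.m * α₀))))) * ((((L ^ i.kk : ℕ) : ℝ))⁻¹) ≤ C₁ * (((L ^ i.kk : ℕ) : ℝ)) ^ (-(min γR (1 / 16))) :=
      mul_le_mul hC₁le hηg hη0 hC₁0
    have ho : (CR * ((L : ℝ) ^ i.kk) ^ (-γR)) ≤ CR * (((L ^ i.kk : ℕ) : ℝ)) ^ (-(min γR (1 / 16))) := mul_le_mul_of_nonneg_left hRg hCR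
    rw [hre]
    linarith [h16g, hB, ho]
  have hdef : Kc * ((((L ^ i.kk : ℕ) : ℝ)) ^ (-(1 / 16 : ℝ)) + ((14 * Real.exp 1 * (1 + Fintype.card (Fin (d + 1))) * basisConst e * ((1 + Fintype.card (Fin (d + 1))) * ((3 + 2 * ((d : ℝ) + 1)) * (c35 * (L : ℝ) ^ i.m * α₀)))) * (1 + Fintype.card (Fin (d + 1) ⊕ Fin (d + 1))) * ((((L ^ i.kk : ℕ) : ℝ))⁻¹) + 2 * (R1c * (20 * ((((L ^ i.kk : ℕ) : ℝ))⁻¹) + 4 * Fintype.card ι * (@basisConst ι _ (Matrix mm mm ℂ) Matrix.frobeniusNormedAddCommGroup Matrix.frobeniusNormedSpace e * (2 * Real.sqrt (Fintype.card mm)) * (Real.sqrt (Fintype.card mm) * ((3 ^ (d + 1) * (72 * ((d : ℝ) + 1) ^ 2 + 9 * ((d : ℝ) + 1)) + (2 + 2 * Real.exp 1 + 2 * Real.exp 1 ^ 2 * ((d : ℝ) + 1))) * ((c35 * (L : ℝ) ^ i.m * α₀) * ((((L ^ i.kk : ℕ) : ℝ))⁻¹))))))) + ((CR * ((L : ℝ)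 ^ i.kk) ^ (-γR)) + (CR * ((L : ℝ) ^ i.kk) ^ (-γR))))) ≤ max (Kb * (basisConst e + G + cR)) (Kc * (1 + C₁ + 2 * CR)) * (((L ^ i.kk : ℕ) : ℝ)) ^ (-(min γR (1 / 16))) := by
    calc Kc * ((((L ^ i.kk : ℕ) : ℝ)) ^ (-(1 / 16 : ℝ)) + ((14 * Real.exp 1 * (1 + Fintype.card (Fin (d + 1))) * basisConst e * ((1 + Fintype.card (Fin (d + 1))) * ((3 + 2 * ((d : ℝ) + 1)) * (c35 * (L : ℝ) ^ i.m * α₀)))) * (1 + Fintype.card (Fin (d + 1) ⊕ Fin (d + 1))) * ((((L ^ i.kk : ℕ) : ℝ))⁻¹) + 2 * (R1c * (20 * ((((L ^ i.kk : ℕ) : ℝ))⁻¹) + 4 * Fintype.card ι * (@basisConst ι _ (Matrix mm mm ℂ) Matrix.frobeniusNormedAddCommGroup Matrix.frobeniusNormedSpace e * (2 * Real.sqrt (Fintype.card mm)) * (Real.sqrt (Fintype.card mm) * ((3 ^ (d + 1) * (72 * ((d : ℝ) + 1) ^ 2 + 9 * ((d : ℝ) + 1)) + (2 + 2 * Real.exp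 1 + 2 * Real.exp 1 ^ 2 * ((d : ℝ) + 1))) * ((c35 * (L : ℝ) ^ i.m * α₀) * ((((L ^ i.kk : ℕ) : ℝ))⁻¹))))))) + ((CR * ((L : ℝ) ^ i.kk) ^ (-γR)) + (CR * ((L : ℝ) ^ i.kk) ^ (-γR))))) ≤ Kc * ((1 + C₁ + 2 * CR) * (((L ^ i.kk : ℕ) : ℝ)) ^ (-(min γR (1 / 16)))) := mul_le_mul_of_nonneg_left hbr hKcpos.le
      _ = (Kc * (1 + C₁ + 2 * CR)) * (((L ^ i.kk : ℕ) : ℝ)) ^ (-(min γR (1 / 16))) := by ring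
      _ ≤ max (Kb * (basisConst e + G + cR)) (Kc * (1 + C₁ + 2 * CR)) * (((L ^ i.kk : ℕ) : ℝ)) ^ (-(min γR (1 / 16))) := mul_le_mul_of_nonneg_right (le_max_right _ _) hxg0
  have hamp0 : 0 ≤ Kb * (basisConst e * (c35 * (L : ℝ) ^ i.m * α₀) + (((1 + Fintype.card ι * (@basisConst ι _ (Matrix mm mm ℂ) Matrix.frobeniusNormedAddCommGroup Matrix.frobeniusNormedSpace e * (2 * Real.sqrt (Fintype.card mm)) * (Real.sqrt (Fintype.card mm) * (2 * ((c35 * (L : ℝ) ^ i.m * α₀) * ((((L ^ i.kk : ℕ) : ℝ))⁻¹)))))) ^ ((d + 2) * L ^ i.kk) - 1) + ((1 + Fintype.card ι * (@basisConst ι _ (Matrix mm mm ℂ) Matrix.frobeniusNormedAddCommGroup Matrix.frobeniusNormedSpace e * (2 * Real.sqrt (Fintype.card mm)) * (Real.sqrt (Fintype.card mm) * (2 * ((c35 * (L : ℝ) ^ i.m * α₀) * ((((L ^ i.r * L ^ i.kk : ℕ) : ℝ))⁻¹)))))) ^ ((d + 2) * (L ^ i.r * L ^ i.kk)) - 1))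 + cR * (c35 * (L : ℝ) ^ i.m * α₀)) := mul_nonneg hKb.le (add_nonneg (add_nonneg (mul_nonneg hκ0 hrA0) (add_nonneg hKC0 hKF0)) hρR0)
  have hbr0 : 0 ≤ ((((L ^ i.kk : ℕ) : ℝ)) ^ (-(1 / 16 : ℝ)) + ((14 * Real.exp 1 * (1 + Fintype.card (Fin (d + 1))) * basisConst e * ((1 + Fintype.card (Fin (d + 1))) * ((3 + 2 * ((d : ℝ) + 1)) * (c35 * (L : ℝ) ^ i.m * α₀)))) * (1 + Fintype.card (Fin (d + 1) ⊕ Fin (d + 1))) * ((((L ^ i.kk : ℕ) : ℝ))⁻¹) + 2 * (R1c * (20 * ((((L ^ i.kk : ℕ) : ℝ))⁻¹) + 4 * Fintype.card ι * (@basisConst ι _ (Matrix mm mm ℂ) Matrix.frobeniusNormedAddCommGroup Matrix.frobeniusNormedSpace e * (2 * Real.sqrt (Fintype.card mm)) * (Real.sqrt (Fintype.card mm) * ((3 ^ (d + 1) * (72 * ((d : ℝ) + 1) ^ 2 + 9 * ((d : ℝ) + 1)) + (2 + 2 * Real.exp 1 + 2 * Real.exp 1 ^ 2 * ((d : ℝ)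 + 1))) * ((c35 * (L : ℝ) ^ i.m * α₀) * ((((L ^ i.kk : ℕ) : ℝ))⁻¹))))))) + ((CR * ((L : ℝ) ^ i.kk) ^ (-γR)) + (CR * ((L : ℝ) ^ i.kk) ^ (-γR))))) := by positivity
  refine ⟨?_, ?_, ?_⟩
  · exact (hasMaj_exp_mono hd hamp0 (min_le_left δb δc) hb).mono fun y y' => mul_le_mul_of_nonneg_right hsize (Real.exp_nonneg _)
  · exact (hasMaj_exp_mono hd hamp0 (min_le_left δb δc) hb').mono fun y y' => mul_le_mul_of_nonneg_right hsize (Real.exp_nonneg _)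
  · exact (hasMaj_exp_mono hd (mul_nonneg hKcpos.le hbr0) (min_le_right δb δc) hc).mono fun y y' => mul_le_mul_of_nonneg_right hdef (Real.exp_nonneg _)

end Summit.QuantumFields.YangMills.BalabanUVNodes.N15.SiteLayerSf

end
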